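import Literature.Probability.Percolation.SupercriticalClusterTransienceSlabs
import HarnessLib

/-!
# The tree of tubes of Grimmett–Kesten–Zhang 1993 (lattice geometry)

Topic `Literature/Probability/Percolation`. A layer of the discharge of the named fact
`GrimmettKestenZhang1993_flow` (`SupercriticalClusterTransience.lean`): the deterministic geometry of §3 of
G. R. Grimmett, H. Kesten, Y. Zhang, PTRF 96 (1993), pp. 38–40 — the 4-ary tree `T` of nodes `x_k(i,j)` ((3.1)),
children `I_k(i,j) = {x_{k+1}(r,s) : r ∈ {2i-1, 2i}, s ∈ {2j-1, 2j}}`, and the tubes `T_k(i,j)` with the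
disjointness properties (3.3) "`T_k(i,j) ∩ T_k(r,s) = ∅` if `(i,j) ≠ (r,s)`" and (3.4) (tubes of far-apart
generations are disjoint).

## Design (a lattice-friendly variant; see the module docstring of the final assembly for why only
## lengths and multiplicities matter for the finite-energy flow)

GKZ place `x_k(i,j)` on the faces of the cubes `B(3^k)` and use straight Euclidean tubes; for the flow
criterion only (a) bounded edge-multiplicity of the tubes and (b) path lengths `ℓ_k` with `Σ_k 4^{-k} ℓ_k < ∞`
matter, so we use axis-`0` as the "radial" direction and let the tree fan out freely in the transverse
coordinates `1, 2` (all other coordinates `0`; `d ≥ 3`):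
* `node d a k i j = (R_k, i d_k, j d_k, 0, …)` with transverse spacing `d_k = dsp a k = 8a(k+1)` (tube radius
  `ak`), children indexed by `(2i+ε₁, 2j+ε₂)`, `ε ∈ {0,1}` (a relabelling of GKZ's `2i-1, 2i`);
* `route d a k i j ε₁ ε₂ m`, `m = 0, …, G_k` — a **staircase** discretisation of the segment from the node to its
  child: radial coordinate `R_k + m`, transverse coordinates `i d_k + ⌊mΔ₁/G_k⌋`, `j d_k + ⌊mΔ₂/G_k⌋`; consecutive
  points are at sup-distance `≤ 1` (`route_succ_mem_ball`); `G_k = gap a k = (2^{k+1}+1) d_{k+1} + 4a(k+2) + 1`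
  exceeds every displacement, `R_{k+1} = R_k + G_k` (`rad`);
* `tube d a k i j ε₁ ε₂ = ⋃_m route(m) + B(ak)`; **(3.3)** `disjoint_tube` (distinct parents of one generation: the
  staircases of parents `i < i'` stay `> 2ak` apart, `staircase_sep`, by monotonicity of `Δ` in `i` and smoothness
  of `⌊mΔ/G⌋`, `div_step_le`); **(3.4)** `gen_le_of_mem_tube_of_mem_tube` (a site lies in tubes of at most two
  consecutive generations); `disjoint_ball_node` (the seed balls of distinct nodes are disjoint);
  `card_tube_le` (`|T| ≤ (G_k+1)(2ak+1)^d`, the length bound (2.2)/(3.16) in lattice form); `le_rad_sub`.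

## References

* G. R. Grimmett, H. Kesten, Y. Zhang, *Random walk on the infinite cluster of the percolation model*, PTRF 96
  (1993) 33–44, §3 (3.1)–(3.4), pp. 38–40 [GrimmettKestenZhang1993].
-/

noncomputable section

namespace Literature.Probability.Percolation

namespace GKZ

open MeasureTheory LatticeModels GM
open scoped Classical

variable {d : ℕ}

/-! ## Points with three prescribed coordinates -/

/-- The point `(a, b, c, 0, …, 0)` of `ℤ^d` (coordinates `0, 1, 2`). [folklore] -/
def pt3 (d : ℕ) [NeZero d] (a b c : ℤ) : Site d :=
  fun j => if j = 0 then a else if j = 1 then b else if j = 2 then c else 0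

section Basic

variable [NeZero d] (hd : 3 ≤ d)
include hd

/-- `0, 1, 2` are distinct coordinate indices for `d ≥ 3`. [folklore] -/
theorem fin012 : (0 : Fin d) ≠ 1 ∧ (0 : Fin d) ≠ 2 ∧ (1 : Fin d) ≠ 2 := by
  have h1 : ((1 : Fin d) : ℕ) = 1 := by rw [Fin.val_one', Nat.one_mod_eq_one.2 (by omega)]
  have h2 : ((2 : Fin d) : ℕ) = 2 := by
    show (2 : ℕ) % d = 2
    exact Nat.mod_eq_of_lt (by omega)
  refine ⟨fun h => ?_, fun h => ?_, fun h => ?_⟩ <;> have := congrArg Fin.val h <;>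
    simp only [Fin.val_zero, h1, h2] at this <;> omega

omit hd in
/-- Coordinate `0` of `pt3`. [folklore] -/
@[simp] theorem pt3_apply_zero (a b c : ℤ) : pt3 d a b c 0 = a := by simp [pt3]

/-- Coordinate `1` of `pt3`. [folklore] -/
@[simp] theorem pt3_apply_one (a b c : ℤ) : pt3 d a b c 1 = b := by
  simp [pt3, (fin012 hd).1.symm]

/-- Coordinate `2` of `pt3`. [folklore] -/
@[simp] theorem pt3_apply_two (a b c : ℤ) : pt3 d a b c 2 = c := by
  simp [pt3, (fin012 hd).2.1.symm, (fin012 hd).2.2.symm]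

omit hd in
/-- The other coordinates of `pt3` vanish. [folklore] -/
theorem pt3_apply_of_ne {j : Fin d} (h0 : j ≠ 0) (h1 : j ≠ 1) (h2 : j ≠ 2) (a b c : ℤ) : pt3 d a b c j = 0 := by
  simp [pt3, h0, h1, h2]

end Basic

/-! ## The parameters of the tree of tubes -/

/-- The transverse spacing `d_k = 8a(k+1)` of the nodes of generation `k` (tube radius `ak`). [cite: GrimmettKestenZhang1993, §3 (3.1) (d_k)] -/
def dsp (a k : ℕ) : ℕ := 8 * a * (k + 1)

/-- The radial length `G_k` of the routes of generation `k`: room for the staircases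
(`≥ (2^{k+1}+1) d_{k+1}`) and margins (`4a(k+2)`). [cite: GrimmettKestenZhang1993, §3 (tubes of length of order β^k)] -/
def gap (a k : ℕ) : ℕ := (2 ^ (k + 1) + 1) * dsp a (k + 1) + 4 * a * (k + 2) + 1

/-- The radial position `R_k = G_0 + ⋯ + G_{k-1}` of generation `k`. [cite: GrimmettKestenZhang1993, §3 (F_k)] -/
def rad (a : ℕ) : ℕ → ℕ
  | 0 => 0
  | k + 1 => rad a k + gap a k

/-- `d_k` is nondecreasing. [folklore] -/
theorem dsp_mono (a : ℕ) {k k' : ℕ} (h : k ≤ k') : dsp a k ≤ dsp a k' := by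
  unfold dsp; exact Nat.mul_le_mul_left _ (by omega)

/-- `R_{k+1} = R_k + G_k`. [folklore] -/
theorem rad_succ (a k : ℕ) : rad a (k + 1) = rad a k + gap a k := rfl

/-- `R` is monotone. [folklore] -/
theorem rad_mono (a : ℕ) : Monotone (rad a) := by
  refine monotone_nat_of_le_succ fun k => ?_
  rw [rad_succ]; exact Nat.le_add_right _ _

/-- The margins: `G_k ≥ 4a(k+2)`. [folklore] -/
theorem gap_ge_margin (a k : ℕ) : 4 * a * (k + 2) + 1 ≤ gap a k := by unfold gap; omega

/-- `G_k > 0`. [folklore] -/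
theorem gap_pos (a k : ℕ) : 0 < gap a k := by unfold gap; omega

/-- `R_k - ak` is nondecreasing in `k` (the generations move outwards faster than the tubes widen). [folklore] -/
theorem rad_sub_mono (a : ℕ) {k k' : ℕ} (h : k ≤ k') : (rad a k : ℤ) - a * k ≤ (rad a k' : ℤ) - a * k' := by
  induction h with
  | refl => exact le_rfl
  | @step m _ ih =>
    refine ih.trans ?_
    rw [rad_succ]
    have := gap_ge_margin a m
    push_cast
    nlinarith

/-! ## Nodes, routes, tubes -/

variable [NeZero d]

/-- The node `x_k(i,j) = (R_k, i d_k, j d_k, 0, …)` of the tree. [cite: GrimmettKestenZhang1993, §3 (3.1) (x_k(i,j))] -/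
def node (d : ℕ) [NeZero d] (a k i j : ℕ) : Site d := pt3 d (rad a k) ((i * dsp a k : ℕ) : ℤ) ((j * dsp a k : ℕ) : ℤ)

/-- The transverse displacement `Δ = (2i+ε) d_{k+1} - i d_k ≥ 0` from a node to a child. [folklore] -/
def disp (a k i : ℕ) (ε : Fin 2) : ℕ := (2 * i + ε) * dsp a (k + 1) - i * dsp a k

/-- **The staircase route** from `x_k(i,j)` to its child `x_{k+1}(2i+ε₁, 2j+ε₂)`: the points
`w(m) = (R_k + m, i d_k + ⌊mΔ₁/G_k⌋, j d_k + ⌊mΔ₂/G_k⌋, 0, …)`, `m = 0, …, G_k` (a lattice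
discretisation of the straight segments of GKZ's tubes `T_k(i,j)`, p. 39). [cite: GrimmettKestenZhang1993, §3 p. 39 (L(u,v), T_k(i,j))] -/
def route (d : ℕ) [NeZero d] (a k i j : ℕ) (ε₁ ε₂ : Fin 2) (m : ℕ) : Site d :=
  pt3 d ((rad a k + m : ℕ) : ℤ) ((i * dsp a k + m * disp a k i ε₁ / gap a k : ℕ) : ℤ)
    ((j * dsp a k + m * disp a k j ε₂ / gap a k : ℕ) : ℤ)

/-- **The tube** of a route: the union of the balls `w(m) + B(ak)`, `m ≤ G_k` (GKZ's `T_k(i,j) =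
B(ak) + L(⋯)`, (3.3)). [cite: GrimmettKestenZhang1993, §3 p. 39 (T_k(i,j) = B(ak) + L)] -/
def tube (d : ℕ) [NeZero d] (a k i j : ℕ) (ε₁ ε₂ : Fin 2) : Finset (Site d) :=
  (Finset.range (gap a k + 1)).biUnion fun m => ball (route d a k i j ε₁ ε₂ m) (a * k)

/-- `i d_k ≤ (2i+ε) d_{k+1}`: the displacement is a genuine difference. [folklore] -/
theorem mul_dsp_le (a k i : ℕ) (ε : Fin 2) : i * dsp a k ≤ (2 * i + ε) * dsp a (k + 1) := by
  calc i * dsp a k ≤ i * dsp a (k + 1) := Nat.mul_le_mul_left _ (dsp_mono a (Nat.le_succ k))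
    _ ≤ (2 * i + ε) * dsp a (k + 1) := Nat.mul_le_mul_right _ (by omega)

/-- The displacement as a difference: `i d_k + Δ = (2i+ε) d_{k+1}`. [folklore] -/
theorem mul_dsp_add_disp (a k i : ℕ) (ε : Fin 2) : i * dsp a k + disp a k i ε = (2 * i + ε) * dsp a (k + 1) := by
  unfold disp; have := mul_dsp_le a k i ε; omega

/-- The displacement fits in the radial length: `Δ ≤ G_k` (for `i < 2^k`). [folklore] -/
theorem disp_le_gap (a k : ℕ) {i : ℕ} (hi : i < 2 ^ k) (ε : Fin 2) : disp a k i ε ≤ gap a k := by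
  unfold disp gap
  have hε : (ε : ℕ) ≤ 1 := by omega
  calc (2 * i + ε) * dsp a (k + 1) - i * dsp a k ≤ (2 * i + ε) * dsp a (k + 1) := Nat.sub_le _ _
    _ ≤ (2 ^ (k + 1) + 1) * dsp a (k + 1) := Nat.mul_le_mul_right _ (by rw [pow_succ]; omega)
    _ ≤ _ := by omega

/-- The displacement is monotone in the parent index: `i ≤ i'` gives `Δ(i, ε) ≤ Δ(i', ε')` unless
`i = i'`. [folklore] -/
theorem disp_mono (a k : ℕ) {i i' : ℕ} (h : i < i') (ε ε' : Fin 2) : disp a k i ε ≤ disp a k i' ε' := by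
  unfold disp
  have hε : (ε : ℕ) ≤ 1 := by omega
  have h1 := mul_dsp_le a k i ε
  have h2 := mul_dsp_le a k i' ε'
  have hD := dsp_mono a (Nat.le_succ k)
  -- as integers
  zify [h1, h2]
  have : (i' : ℤ) - i ≥ 1 := by omega
  nlinarith [hD, Nat.zero_le (dsp a k)]

/-- **Smoothness of the staircase**: `⌊m'Δ/G⌋ ≤ ⌊mΔ/G⌋ + (m' - m)` for `m ≤ m'`, `Δ ≤ G`. [folklore] -/
theorem div_step_le {Δ G m m' : ℕ} (hG : 0 < G) (hΔ : Δ ≤ G) (h : m ≤ m') :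
    m' * Δ / G ≤ m * Δ / G + (m' - m) := by
  have hlt : m * Δ < (m * Δ / G + 1) * G := Nat.lt_mul_of_div_lt (Nat.lt_succ_self _) hG
  have : m' * Δ < (m * Δ / G + 1 + (m' - m)) * G := by
    have : m' * Δ = m * Δ + (m' - m) * Δ := by
      rw [← Nat.add_mul]; congr 1; omega
    rw [this]
    nlinarith [Nat.mul_le_mul_left (m' - m) hΔ]
  have := (Nat.div_lt_iff_lt_mul hG).2 this
  omega

/-! ## Coordinates of the route points -/

section Coords

variable (hd : 3 ≤ d)
include hd

omit hd in
/-- Coordinate `0` of a route point. [folklore] -/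
theorem route_apply_zero (a k i j : ℕ) (ε₁ ε₂ : Fin 2) (m : ℕ) : route d a k i j ε₁ ε₂ m 0 = ((rad a k + m : ℕ) : ℤ) := by
  simp [route]

/-- Coordinate `1` of a route point. [folklore] -/
theorem route_apply_one (a k i j : ℕ) (ε₁ ε₂ : Fin 2) (m : ℕ) :
    route d a k i j ε₁ ε₂ m 1 = ((i * dsp a k + m * disp a k i ε₁ / gap a k : ℕ) : ℤ) := by
  simp only [route, pt3_apply_one hd]

/-- Coordinate `2` of a route point. [folklore] -/
theorem route_apply_two (a k i j : ℕ) (ε₁ ε₂ : Fin 2) (m : ℕ) :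
    route d a k i j ε₁ ε₂ m 2 = ((j * dsp a k + m * disp a k j ε₂ / gap a k : ℕ) : ℤ) := by
  simp only [route, pt3_apply_two hd]

omit hd in
/-- The other coordinates of a route point vanish. [folklore] -/
theorem route_apply_of_ne {jj : Fin d} (h0 : jj ≠ 0) (h1 : jj ≠ 1) (h2 : jj ≠ 2) (a k i j : ℕ) (ε₁ ε₂ : Fin 2) (m : ℕ) :
    route d a k i j ε₁ ε₂ m jj = 0 := by
  simp [route, pt3_apply_of_ne h0 h1 h2]

omit hd in
/-- The route starts at the node. [folklore] -/
theorem route_zero (a k i j : ℕ) (ε₁ ε₂ : Fin 2) : route d a k i j ε₁ ε₂ 0 = node d a k i j := by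
  simp [route, node]

/-- The route ends at the child. [folklore] -/
theorem route_gap (a k i j : ℕ) (ε₁ ε₂ : Fin 2) :
    route d a k i j ε₁ ε₂ (gap a k) = node d a (k + 1) (2 * i + ε₁) (2 * j + ε₂) := by
  have hG : 0 < gap a k := gap_pos a k
  funext jj
  by_cases h0 : jj = 0
  · subst h0; simp [route, node, rad_succ]
  by_cases h1 : jj = 1
  · subst h1
    simp only [route, node, pt3_apply_one hd]
    rw [Nat.mul_div_cancel_left _ hG, mul_dsp_add_disp]
  by_cases h2 : jj = 2
  · subst h2
    simp only [route, node, pt3_apply_two hd]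
    rw [Nat.mul_div_cancel_left _ hG, mul_dsp_add_disp]
  · simp only [route, node, pt3_apply_of_ne h0 h1 h2]

/-- **Consecutive route points are within sup-distance `1`** (`i, j < 2^k`). [folklore] -/
theorem route_succ_mem_ball (a k : ℕ) {i j : ℕ} (hi : i < 2 ^ k) (hj : j < 2 ^ k) (ε₁ ε₂ : Fin 2) (m : ℕ) :
    route d a k i j ε₁ ε₂ (m + 1) ∈ ball (route d a k i j ε₁ ε₂ m) 1 := by
  have hG : 0 < gap a k := gap_pos a k
  rw [GM.mem_ball]
  intro jj
  by_cases h0 : jj = 0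
  · subst h0; rw [route_apply_zero, route_apply_zero]; push_cast; constructor <;> linarith
  by_cases h1 : jj = 1
  · subst h1; rw [route_apply_one hd, route_apply_one hd]
    have h := div_step_le (m := m) (m' := m + 1) hG (disp_le_gap a k hi ε₁) (Nat.le_succ m)
    have h' : m * disp a k i ε₁ / gap a k ≤ (m + 1) * disp a k i ε₁ / gap a k :=
      Nat.div_le_div_right (Nat.mul_le_mul_right _ (Nat.le_succ m))
    simp only [Nat.cast_add, Nat.cast_one]; constructor <;> omega
  by_cases h2 : jj = 2
  · subst h2; rw [route_apply_two hd, route_apply_two hd]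
    have h := div_step_le (m := m) (m' := m + 1) hG (disp_le_gap a k hj ε₂) (Nat.le_succ m)
    have h' : m * disp a k j ε₂ / gap a k ≤ (m + 1) * disp a k j ε₂ / gap a k :=
      Nat.div_le_div_right (Nat.mul_le_mul_right _ (Nat.le_succ m))
    simp only [Nat.cast_add, Nat.cast_one]; constructor <;> omega
  · rw [route_apply_of_ne h0 h1 h2, route_apply_of_ne h0 h1 h2]; simp

end Coords

/-! ## Separation of tubes and of nodes; sizes -/

section Separation

variable (hd : 3 ≤ d)

omit [NeZero d] in
/-- Triangle inequality for sup-norm balls. [folklore] -/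
theorem ball_subset_ball_of_mem {x y : Site d} {s : ℕ} (hy : y ∈ ball x s) (r : ℕ) : ball y r ⊆ ball x (r + s) := by
  intro z hz
  rw [GM.mem_ball] at hy hz ⊢
  intro i; have := hy i; have := hz i; push_cast; constructor <;> omega

omit [NeZero d] in
/-- Two points of a common ball are within twice the radius. [folklore] -/
theorem abs_sub_le_of_mem_ball {x z z' : Site d} {r : ℕ} (hz : z ∈ ball x r) (hz' : z' ∈ ball x r) (i : Fin d) :
    |z i - z' i| ≤ 2 * r := by
  rw [GM.mem_ball] at hz hz'
  have := hz i; have := hz' i; rw [abs_le]; constructor <;> omega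

/-- The balls of the route points lie in the tube. [folklore] -/
theorem ball_route_subset_tube (a k i j : ℕ) (ε₁ ε₂ : Fin 2) {m : ℕ} (hm : m ≤ gap a k) :
    ball (route d a k i j ε₁ ε₂ m) (a * k) ⊆ tube d a k i j ε₁ ε₂ := by
  unfold tube
  exact Finset.subset_biUnion_of_mem (fun m => ball (route d a k i j ε₁ ε₂ m) (a * k)) (Finset.mem_range.2 (by omega))

/-- Membership in a tube. [folklore] -/
theorem mem_tube {a k i j : ℕ} {ε₁ ε₂ : Fin 2} {z : Site d} :
    z ∈ tube d a k i j ε₁ ε₂ ↔ ∃ m, m ≤ gap a k ∧ z ∈ ball (route d a k i j ε₁ ε₂ m) (a * k) := by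
  unfold tube
  rw [Finset.mem_biUnion]
  constructor
  · rintro ⟨m, hm, hz⟩; exact ⟨m, Nat.lt_succ_iff.1 (Finset.mem_range.1 hm), hz⟩
  · rintro ⟨m, hm, hz⟩; exact ⟨m, Finset.mem_range.2 (Nat.lt_succ_of_le hm), hz⟩

/-- **The size of a tube**: `|tube| ≤ (G_k + 1)(2ak+1)^d`. [folklore] -/
theorem card_tube_le (a k i j : ℕ) (ε₁ ε₂ : Fin 2) : (tube d a k i j ε₁ ε₂).card ≤ (gap a k + 1) * (2 * (a * k) + 1) ^ d := by
  unfold tube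
  calc ((Finset.range (gap a k + 1)).biUnion fun m => ball (route d a k i j ε₁ ε₂ m) (a * k)).card
      ≤ ∑ m ∈ Finset.range (gap a k + 1), (ball (route d a k i j ε₁ ε₂ m) (a * k)).card := Finset.card_biUnion_le
    _ = (gap a k + 1) * (2 * (a * k) + 1) ^ d := by simp [card_ball]

/-- The radial range of a tube: `R_k - ak ≤ z₀ ≤ R_k + G_k + ak`. [folklore] -/
theorem radial_of_mem_tube {a k i j : ℕ} {ε₁ ε₂ : Fin 2} {z : Site d} (hz : z ∈ tube d a k i j ε₁ ε₂) :
    (rad a k : ℤ) - a * k ≤ z 0 ∧ z 0 ≤ rad a k + gap a k + a * k := by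
  obtain ⟨m, hm, hz⟩ := mem_tube.1 hz
  have h0 := (GM.mem_ball.1 hz) 0
  rw [route_apply_zero] at h0
  push_cast at h0 ⊢
  constructor <;> nlinarith [h0.1, h0.2]

/-- **Tubes of generations two or more apart are disjoint**: a point in tubes of generations `k` and
`k'` has `k' ≤ k + 1`. [cite: GrimmettKestenZhang1993, §3 (3.3)–(3.4)] -/
theorem gen_le_of_mem_tube_of_mem_tube {a k k' i j i' j' : ℕ} {ε₁ ε₂ ε₁' ε₂' : Fin 2} {z : Site d}
    (hz : z ∈ tube d a k i j ε₁ ε₂) (hz' : z ∈ tube d a k' i' j' ε₁' ε₂') : k' ≤ k + 1 := by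
  by_contra hcon
  push Not at hcon
  have h1 := (radial_of_mem_tube hz).2
  have h2 := (radial_of_mem_tube hz').1
  have h3 := rad_sub_mono a (show k + 2 ≤ k' by omega)
  have h4 := gap_ge_margin a (k + 1)
  rw [rad_succ, rad_succ] at h3
  push_cast at h3
  nlinarith

include hd

omit [NeZero d] hd in
/-- **One-dimensional separation of the staircases of two parents** (`i < i'`, `a ≥ 1`): at radial
parameters `m, m'` within `2ak` of each other, the first transverse coordinates differ by more than
`2ak`. Uses `d_k = 8a(k+1)`, monotonicity `Δ ≤ Δ'` and the smoothness of `⌊mΔ/G⌋`. [folklore] -/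
theorem staircase_sep {a : ℕ} (ha : 1 ≤ a) {k m m' i i' Δ Δ' : ℕ} (hmm : (m : ℤ) - m' ≤ 2 * ((a * k : ℕ) : ℤ)) (hii : i < i')
    (hΔ : Δ ≤ Δ') (hΔG : Δ ≤ gap a k) :
    ((i * dsp a k + m * Δ / gap a k : ℕ) : ℤ) + 2 * ((a * k : ℕ) : ℤ) < ((i' * dsp a k + m' * Δ' / gap a k : ℕ) : ℤ) := by
  have hG := gap_pos a k
  have hA : m * Δ / gap a k ≤ m' * Δ' / gap a k + 2 * (a * k) := by
    rcases le_or_gt m m' with h | h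
    · calc m * Δ / gap a k ≤ m' * Δ / gap a k := Nat.div_le_div_right (Nat.mul_le_mul_right _ h)
        _ ≤ m' * Δ' / gap a k := Nat.div_le_div_right (Nat.mul_le_mul_left _ hΔ)
        _ ≤ _ := Nat.le_add_right _ _
    · have h1 := div_step_le hG hΔG h.le
      have h2 : m' * Δ / gap a k ≤ m' * Δ' / gap a k := Nat.div_le_div_right (Nat.mul_le_mul_left _ hΔ)
      have h3 : (m : ℤ) - m' = ((m - m' : ℕ) : ℤ) := by omega
      have h4 : ((m - m' : ℕ) : ℤ) ≤ 2 * ((a * k : ℕ) : ℤ) := h3 ▸ hmm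
      have h5 : m - m' ≤ 2 * (a * k) := by exact_mod_cast h4
      omega
  have hD : i * dsp a k + dsp a k ≤ i' * dsp a k := by
    calc i * dsp a k + dsp a k = (i + 1) * dsp a k := by ring
      _ ≤ i' * dsp a k := Nat.mul_le_mul_right _ hii
  have hDbig : 4 * (a * k) + 1 ≤ dsp a k := by unfold dsp; nlinarith
  have key : i * dsp a k + m * Δ / gap a k + 2 * (a * k) < i' * dsp a k + m' * Δ' / gap a k := by omega
  have := (Nat.cast_lt (α := ℤ)).2 key
  push_cast [Nat.cast_add] at this ⊢
  linarith

/-- **(3.3): tubes of distinct nodes of the same generation are disjoint** (`a ≥ 1`, indices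
`< 2^k`). [cite: GrimmettKestenZhang1993, §3 (3.3) p. 39] -/
theorem disjoint_tube {a : ℕ} (ha : 1 ≤ a) {k i j i' j' : ℕ} (hi : i < 2 ^ k) (hj : j < 2 ^ k) (hi' : i' < 2 ^ k)
    (hj' : j' < 2 ^ k) (hne : (i, j) ≠ (i', j')) (ε₁ ε₂ ε₁' ε₂' : Fin 2) :
    Disjoint (tube d a k i j ε₁ ε₂) (tube d a k i' j' ε₁' ε₂') := by
  rw [Finset.disjoint_left]
  intro z hz hz'
  obtain ⟨m, hm, hzm⟩ := mem_tube.1 hz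
  obtain ⟨m', hm', hzm'⟩ := mem_tube.1 hz'
  -- radial proximity
  have h0 := (GM.mem_ball.1 hzm) 0
  have h0' := (GM.mem_ball.1 hzm') 0
  rw [route_apply_zero] at h0 h0'
  simp only [Nat.cast_add] at h0 h0'
  have hmm : (m : ℤ) - m' ≤ 2 * ((a * k : ℕ) : ℤ) ∧ (m' : ℤ) - m ≤ 2 * ((a * k : ℕ) : ℤ) := by
    constructor <;> linarith [h0.1, h0.2, h0'.1, h0'.2]
  -- transverse proximity
  have h1 := (GM.mem_ball.1 hzm) 1
  have h1' := (GM.mem_ball.1 hzm') 1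
  have h2 := (GM.mem_ball.1 hzm) 2
  have h2' := (GM.mem_ball.1 hzm') 2
  rw [route_apply_one hd] at h1 h1'
  rw [route_apply_two hd] at h2 h2'
  rcases lt_trichotomy i i' with hii | rfl | hii
  · have := staircase_sep ha hmm.1 hii (disp_mono a k hii ε₁ ε₁') (disp_le_gap a k hi ε₁)
    linarith [h1.1, h1.2, h1'.1, h1'.2]
  · have hjj : j ≠ j' := fun h => hne (by rw [h])
    rcases lt_or_gt_of_ne hjj with hjj | hjj
    · have := staircase_sep ha hmm.1 hjj (disp_mono a k hjj ε₂ ε₂') (disp_le_gap a k hj ε₂)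
      linarith [h2.1, h2.2, h2'.1, h2'.2]
    · have := staircase_sep ha hmm.2 hjj (disp_mono a k hjj ε₂' ε₂) (disp_le_gap a k hj' ε₂')
      linarith [h2.1, h2.2, h2'.1, h2'.2]
  · have := staircase_sep ha hmm.2 hii (disp_mono a k hii ε₁' ε₁) (disp_le_gap a k hi' ε₁')
    linarith [h1.1, h1.2, h1'.1, h1'.2]

/-- **Nodes are well separated**: the balls `x_k(i,j) + B(ak)` of distinct nodes are disjoint
(`a ≥ 1`). [cite: GrimmettKestenZhang1993, §3 (3.1) (d(x_k(i,j), x_k(r,s)) ≥ d_k)] -/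
theorem disjoint_ball_node {a : ℕ} (ha : 1 ≤ a) {k i j k' i' j' : ℕ} (hne : (k, i, j) ≠ (k', i', j')) :
    Disjoint (ball (node d a k i j) (a * k)) (ball (node d a k' i' j') (a * k')) := by
  rw [Finset.disjoint_left]
  intro z hz hz'
  rw [GM.mem_ball] at hz hz'
  rcases lt_trichotomy k k' with hkk | rfl | hkk
  · have h := (hz 0).2; have h' := (hz' 0).1
    simp only [node, pt3_apply_zero] at h h'
    have h3 := rad_sub_mono a (show k + 1 ≤ k' by omega)
    have h4 : ((4 * a * (k + 2) + 1 : ℕ) : ℤ) ≤ gap a k := by exact_mod_cast gap_ge_margin a k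
    rw [rad_succ] at h3; push_cast at h3 h4 h h'
    nlinarith
  · have hdsp : dsp a k = 8 * a * (k + 1) := rfl
    by_cases hii : i = i'
    · subst hii
      have hjj : j ≠ j' := fun h => hne (by rw [h])
      have h := hz 2; have h' := hz' 2
      simp only [node, pt3_apply_two hd] at h h'
      rcases lt_or_gt_of_ne hjj with hjj | hjj
      · have : j * dsp a k + dsp a k ≤ j' * dsp a k := by
          calc j * dsp a k + dsp a k = (j + 1) * dsp a k := by ring
            _ ≤ j' * dsp a k := Nat.mul_le_mul_right _ hjj
        push_cast [hdsp] at this h h'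
        nlinarith [h.1, h.2, h'.1, h'.2]
      · have : j' * dsp a k + dsp a k ≤ j * dsp a k := by
          calc j' * dsp a k + dsp a k = (j' + 1) * dsp a k := by ring
            _ ≤ j * dsp a k := Nat.mul_le_mul_right _ hjj
        push_cast [hdsp] at this h h'
        nlinarith [h.1, h.2, h'.1, h'.2]
    · have h := hz 1; have h' := hz' 1
      simp only [node, pt3_apply_one hd] at h h'
      rcases lt_or_gt_of_ne hii with hii | hii
      · have : i * dsp a k + dsp a k ≤ i' * dsp a k := by
          calc i * dsp a k + dsp a k = (i + 1) * dsp a k := by ring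
            _ ≤ i' * dsp a k := Nat.mul_le_mul_right _ hii
        push_cast [hdsp] at this h h'
        nlinarith [h.1, h.2, h'.1, h'.2]
      · have : i' * dsp a k + dsp a k ≤ i * dsp a k := by
          calc i' * dsp a k + dsp a k = (i' + 1) * dsp a k := by ring
            _ ≤ i * dsp a k := Nat.mul_le_mul_right _ hii
        push_cast [hdsp] at this h h'
        nlinarith [h.1, h.2, h'.1, h'.2]
  · have h := (hz 0).1; have h' := (hz' 0).2
    simp only [node, pt3_apply_zero] at h h'
    have h3 := rad_sub_mono a (show k' + 1 ≤ k by omega)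
    have h4 : ((4 * a * (k' + 2) + 1 : ℕ) : ℤ) ≤ gap a k' := by exact_mod_cast gap_ge_margin a k'
    rw [rad_succ] at h3; push_cast at h3 h4 h h'
    nlinarith

end Separation

/-! ## Growth of the radii -/

/-- `R_k - ak ≥ k`: the generations escape to infinity (finitely many tubes meet a given site). [folklore] -/
theorem le_rad_sub (a k : ℕ) : (k : ℤ) ≤ (rad a k : ℤ) - a * k := by
  induction k with
  | zero => simp [rad]
  | succ k ih =>
    rw [rad_succ]
    have := gap_ge_margin a k
    push_cast
    nlinarith

/-- A site in a tube of generation `k` has `k ≤ z₀`. [folklore] -/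
theorem gen_le_coord_of_mem_tube {a k i j : ℕ} {ε₁ ε₂ : Fin 2} {z : Site d} (hz : z ∈ tube d a k i j ε₁ ε₂) :
    (k : ℤ) ≤ z 0 :=
  (le_rad_sub a k).trans (radial_of_mem_tube hz).1

end GKZ

end Literature.Probability.Percolation
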